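import Summits.QuantumFields.BalabanUV.Beta.FP.PerfectAsymptoticsBF
import Summits.QuantumFields.BalabanUV.Beta.FP.PerfectFullSandwich

/-!
# `BalabanUV.Beta.FP.FineSplitJunction` — road «FP» for binder row D1, row KER-γ «THE JUNCTION», its SOCKET (α0):
# `hsplit` ⟸ A FINE-TABLE SPLIT, IN THE SANDWICH CONVENTION — the END's column transport
# `N⁸·dressedEntry (colOf K) (truncK K_END N) (N•u)` IS `dressedEntryP (c a ↦ colH K N a 0 c) ((s,s′) ↦ N⁸·truncK K_END N c e (s′−s)) (N•(−u))`
# (SAME columns, SAME evaluation point as `PerfectFullSandwich.TPerfOf_vertex2OfK_eq_dressedEntryP`, `K_END` UNFLIPPED), the sandwich is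
# linear in the fine two-point table over BOUNDED tables, hence the END's `hsplit` follows from a split of FINE two-point tables and the pieces'
# coarse (rem) currency is inherited; composed into `PerfectAsymptoticsBF.hasym_PiBF_of_pieces` (p248226 ✓)

HONEST DEPENDENCY (page 1, mandatory): continuum YM on T⁴ ⇐ BetaPertH ∧ nine spine estimates (0/9 proved); BetaPertH ⇐ (D1) ∧ (D4) ∧
CAP+tail; G-an2-4 gates asym, D1 and NE2/3/4.  HONEST FRAMING (cell contract, verbatim): «discharging `BetaPertH` makes Bałaban's UV
stability UNCONDITIONAL — a real constructive-QFT result; it is NOT the continuum limit and NOT the Clay problem.»  THIS MODULE is [folklore]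
bookkeeping of absolutely convergent lattice sums over `ℝ`, composed BY NAME from the tree: `DecimatedMomentSummable.dressedSum`,
`DressedMomentNormalisation.dressedEntry`, `MomentTransferPeriodicSum.dressedSumP`, `MomentTransferPeriodicEntry.dressedEntryP`,
`TransportInfinityM.colOf`, `OneStepKernelFamily.colH`, `HorizontalBookkeeping.truncK`, the γ-END capstone `PerfectAsymptoticsBF.hasym_PiBF_of_pieces`
(road-FP OWNER d1-p3-g8), the sandwich `PerfectFullSandwich.TPerfOf_vertex2OfK_eq_dressedEntryP` and the K-side letters of the perfect resolvent
(`StepLawKHolds.exists_decays_KPerf_holds`, `SymmetryK.shiftK_KPerf`, `PerfectBubbleSandwich.entryHyps_perfCol_zero`).  It answers INFO I-d1leaf01g10-3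
(journal l.26937: «`K_END = PiBF` in its native convention; the END's columns are the `p ↦ −p` reflection of the sandwich's») AS A KERNEL LEMMA,
so that the remaining KER-γ items (α2) «`F m = N⁸·(six loops)` entrywise» and (γ) «jet normalisation» are statements about FINE TWO-POINT TABLES ONLY.
No `def`, no `def … : Prop`, nothing cited, nothing of the manuscripts under audit asserted, 0 sorry.  WHAT IT IS NOT: not the fine split
itself (KER-γ (α2)), not the piece ledger (rem), not N0b-W (whether `WPerfOf` has the bi-vertex form), hence NOT `hsplit` for the road's literal,
NOT (ASYMP), NOT D1; 0∕4 row-D1 binders; NOT BetaPertH, NOT continuum, NOT Clay.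

ABSOLUTE RULE (cell charter, verbatim): «No internally-minted statement may enter as a cited fact. Every hypothesis is either kernel-proved in this
package or a verbatim quotation of a PUBLISHED theorem with page reference. The manuscript(s) under audit are NOT citable for their own disputed
steps — they are the thing under adjudication; programme-internal (2001/route/tribunal) claims are never citable.»

CONTENT (all [folklore]):
* §1 `dressedSum_neg_neg` (reflecting both patterns reflects the kernel and the output point), `colOf_eq_colH_neg`,
  **`dressedEntry_colOf_eq_dressedEntryP`** (`dressedEntry (colOf K) T y a b = dressedEntryP (c a ↦ colH K n a 0 c) ((c e s s′) ↦ T c e (s′ − s)) (−y) a b`,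
  any `n`), `dressedSumP_const_mul`, `dressedEntryP_const_mul`, **`transport_eq_dressedEntryP`** (the END's transport in sandwich form).
* §2 `summable_dressedP_fibre_of_bounded` (bounded two-point table, absolutely summable patterns — NO `AbsMoment₂` asked of the fine side: a `‖z‖⁻⁶`
  tail has none in `d = 4`), `dressedSumP_split`, **`dressedEntryP_split`** (the sandwich of `F` minus the sandwich of `P` is the sum of the sandwiches
  of the pieces, when `F − P = Σ pieces` entrywise).
* §3 **`hsplit_of_fineSplit`** — THE ADAPTER: sandwich form of `T m` + fine split of `F m` against `N⁸·truncK K_f N (s′−s)` + bounded pieces + absolutely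
  summable columns ⟹ the END's `hsplit` LITERALLY, with `D i m u := dressedEntryP (colH-columns) (G i m) (N•(−u)) μ ν`.
* §4 **`hasym_PiBF_of_fineSplit`** — `hasym_PiBF_of_pieces` with `hsplit` REPLACED by (sandwich, fine split, bounded pieces) at the perfect columns
  (`K m := KPerf Lc (sfStep Lc) (smStep 3 Lc) m`, `N := Lc^m`; the column letter discharged by `entryHyps_perfCol_zero`, the boundedness of `PiBF` by
  `sextic_PiBF`), `hpieces` stated on the induced pieces.
* (sequel `FP/FineSplitJunctionBiVertex`: the bi-vertex slot `W m := vertex2OfK (KPerf…m) (Lc^m) (Wf m)`, sandwich hypothesis DISCHARGED by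
  `TPerfOf_vertex2OfK_eq_dressedEntryP`.)
Provenance: D1 formalisation swarm LEAF PROVER 01, unit `b2b-balaban-beta-d1-formalise-leaf-01` gen 11 (prover-b2b-balaban-beta-d1-formalise-leaf-01-g11-0),
2026-08-21, road FP row KER-γ (R-FP-31 ∕ R-FP-33 (c)); «not in print; our bookkeeping».
-/

noncomputable section

namespace Summit.QuantumFields.BalabanUV.Beta.FP.FineSplitJunction

open Finset
open scoped BigOperators
open Literature.MathematicalPhysics.QuantumFieldTheory.Balaban1983to89
open Literature.MathematicalPhysics.QuantumFieldTheory.Balaban1983to89.Beta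
open Literature.MathematicalPhysics.QuantumFieldTheory.Balaban1983to89.Beta.BubbleTransfer (c4)
open Literature.MathematicalPhysics.QuantumFieldTheory.Balaban1983to89.B12Normalization (stepBal)
open B12Sec2to5 (l1)
open PolarizationSign (reflSign)
open ExpKernelCalculus (Site MKer Decays BiLoc comp shiftK)
open OneStepResolventKernel (Fib LocStencil)
open OneStepKernelFamily (colH)
open KernelWard (divV divW)
open KernelReflection (LegMap refK bondRefl)
open DyadicShell (Pt supNorm)
open DecimatedMomentSummable (AbsMoment₂ dressedSum summable_of_absMoment₂)
open DressedMomentNormalisation (EKer dressedEntry)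
open LeadingCoefficient (kappaBal)
open Summit.QuantumFields.BalabanUV.Beta.GAN24.CombesThomas (sfStep smStep)
open Summit.QuantumFields.BalabanUV.Beta.D1BFx.MomentTransferPeriodic (Ker₂)
open Summit.QuantumFields.BalabanUV.Beta.D1BFx.MomentTransferPeriodicSum (dressedSumP dressedSumP_of_transl)
open Summit.QuantumFields.BalabanUV.Beta.D1BFx.MomentTransferPeriodicEntry (EKer₂ dressedEntryP)
open Summit.QuantumFields.BalabanUV.Beta.FP.PerfectObjectsT (KPerf)
open Summit.QuantumFields.BalabanUV.Beta.FP.TransportInfinityM (colOf colOf_apply)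
open Summit.QuantumFields.BalabanUV.Beta.FP.HorizontalBookkeeping (truncK)
open Summit.QuantumFields.BalabanUV.Beta.FP.WilsonCubicGerm (cubicGermOf)
open Summit.QuantumFields.BalabanUV.Beta.FP.GhostCubicGerm (cubicGermOfSc)
open Summit.QuantumFields.BalabanUV.Beta.FP.BubbleGermValue (bfGerm ghostGerm)
open Summit.QuantumFields.BalabanUV.Beta.FP.PerfectPolarization (Pker G0ker PiBF)
open Summit.QuantumFields.BalabanUV.Beta.FP.PerfectPolarizationDecay (sextic_PiBF)
open Summit.QuantumFields.BalabanUV.Beta.FP.PerfectAsymptoticsBF (hasym_PiBF_of_pieces)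
open Summit.QuantumFields.BalabanUV.Beta.FP.PerfectBubbleSandwich (entryHyps_perfCol_zero)

/-! ## §1 The END's column transport in the sandwich convention -/

section Reflect

variable {D : ℕ}

/-- [folklore] Reflecting BOTH dressing patterns reflects the middle kernel and the output point:
`Σ'_{(u,x)} w(−u)·T(y+u−x)·w′(−x) = Σ'_{(u,x)} w u·T(−(−y+u−x))·w′ x` (reindexing `(u,x) ↦ (−u,−x)`; no summability needed). -/
theorem dressedSum_neg_neg (w T w' : Site D → ℝ) (y : Site D) :
    dressedSum (fun u => w (-u)) T (fun x => w' (-x)) y = dressedSum w (fun z => T (-z)) w' (-y) := by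
  unfold dressedSum
  rw [← (Equiv.neg (Site D × Site D)).tsum_eq]
  refine tsum_congr fun p => ?_
  have h : y + (-p).1 - (-p).2 = -(-y + p.1 - p.2) := by
    rw [Prod.fst_neg, Prod.snd_neg]; abel
  show w (-(-p).1) * T (y + (-p).1 - (-p).2) * w' (-(-p).2) = w p.1 * T (-(-y + p.1 - p.2)) * w' p.2
  rw [h, Prod.fst_neg, Prod.snd_neg, neg_neg, neg_neg]

/-- [folklore] The END's column `colOf K c a p = K (−p) 0 (inl c) (inr a)` is the `p ↦ −p` reflection of the sandwich's base-`0` column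
`colH K n a 0 c` (any block size `n`: the coarse base point is `n•0 = 0`). -/
theorem colOf_eq_colH_neg (K : MKer (3 + 1) (Fib 3)) (n : ℕ) (c a : Fin 4) (p : Site 4) :
    colOf K c a p = colH K n a 0 c (-p) := by
  rw [colOf_apply]; unfold colH; rw [smul_zero]

/-- [folklore] **THE END's TRANSPORT SANDWICH IN THE SANDWICH CONVENTION**: for every matrix kernel `T` and every `n`,
`dressedEntry (colOf K) T y a b = dressedEntryP (c a ↦ colH K n a 0 c) ((c e s s′) ↦ T c e (s′ − s)) (−y) a b` — the SAME column family as
`PerfectFullSandwich.TPerfOf_vertex2OfK_eq_dressedEntryP`, the two-point table `(s, s′) ↦ T(s′ − s)` (second bond minus first), the REFLECTED output point. -/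
theorem dressedEntry_colOf_eq_dressedEntryP (K : MKer (3 + 1) (Fib 3)) (n : ℕ) (T : EKer 4) (y : Site 4) (a b : Fin 4) :
    dressedEntry (colOf K) T y a b
      = dressedEntryP (fun c a' => colH K n a' 0 c) (fun c e s s' => T c e (s' - s)) (-y) a b := by
  unfold dressedEntry dressedEntryP
  refine Finset.sum_congr rfl fun c _ => Finset.sum_congr rfl fun e _ => ?_
  have hw : colOf K c a = fun u => colH K n a 0 c (-u) := funext fun u => colOf_eq_colH_neg K n c a u
  have hw' : colOf K e b = fun u => colH K n b 0 e (-u) := funext fun u => colOf_eq_colH_neg K n e b u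
  rw [hw, hw', dressedSum_neg_neg, ← dressedSumP_of_transl]
  congr 1
  funext s s'
  show T c e (-(s - s')) = T c e (s' - s)
  rw [neg_sub]

/-- [folklore] A constant factor of the two-point table comes out of the dressed sum (no summability needed). -/
theorem dressedSumP_const_mul (w : Site D → ℝ) (P : Ker₂ D) (w' : Site D → ℝ) (r : ℝ) (y : Site D) :
    dressedSumP w (fun s s' => r * P s s') w' y = r * dressedSumP w P w' y := by
  unfold dressedSumP
  rw [← tsum_mul_left]
  exact tsum_congr fun p => by ring

/-- [folklore] A constant factor of the fine matrix table comes out of the sandwich. -/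
theorem dressedEntryP_const_mul (w : EKer D) (P : EKer₂ D) (r : ℝ) (y : Site D) (a b : Fin D) :
    dressedEntryP w (fun c e s s' => r * P c e s s') y a b = r * dressedEntryP w P y a b := by
  unfold dressedEntryP
  rw [Finset.mul_sum]
  refine Finset.sum_congr rfl fun c _ => ?_
  rw [Finset.mul_sum]
  exact Finset.sum_congr rfl fun e _ => dressedSumP_const_mul _ _ _ r _

/-- [folklore] **THE END's COLUMN TRANSPORT IN SANDWICH FORM** (the `Xtr` of `RemainderLedgerCov.hasym_perfect_of_pieces_cov` ∕
`PerfectAsymptoticsBF.hasym_PiBF_of_pieces`): for every packed kernel `K`, block size `N`, fine kernel `K_f` and coarse point `u`,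
`N⁸ · dressedEntry (colOf K) (truncK K_f N) (N•u) μ ν = dressedEntryP (c a ↦ colH K N a 0 c) ((c e s s′) ↦ N⁸·truncK K_f N c e (s′ − s)) (N•(−u)) μ ν`
— columns and evaluation point LITERALLY those of `TPerfOf_vertex2OfK_eq_dressedEntryP`; `K_f` enters UNFLIPPED. -/
theorem transport_eq_dressedEntryP (K : MKer (3 + 1) (Fib 3)) (N : ℕ) (Kf : EKer 4) (u : Pt) (μ ν : Fin 4) :
    (N : ℝ) ^ 8 * dressedEntry (colOf K) (truncK Kf N) ((N : ℤ) • u) μ ν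
      = dressedEntryP (fun c a => colH K N a 0 c) (fun c e s s' => (N : ℝ) ^ 8 * truncK Kf N c e (s' - s)) ((N : ℤ) • (-u)) μ ν := by
  rw [dressedEntry_colOf_eq_dressedEntryP K N, smul_neg, dressedEntryP_const_mul]

end Reflect

/-! ## §2 Linearity of the sandwich in the fine two-point table over bounded tables -/

section Linear

variable {D : ℕ}

/-- [folklore] The fibre `(u, x) ↦ w u · P (y + u) x · w′ x` of the two-point dressed sum is summable as soon as `P` is BOUNDED and `|w|`, `|w′|`
are summable (no moment condition on the fine side). -/
theorem summable_dressedP_fibre_of_bounded {w w' : Site D → ℝ} {P : Ker₂ D} {A : ℝ} (hw : Summable fun u => |w u|)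
    (hP : ∀ s s', |P s s'| ≤ A) (hw' : Summable fun x => |w' x|) (y : Site D) :
    Summable (fun p : Site D × Site D => w p.1 * P (y + p.1) p.2 * w' p.2) := by
  have hA : 0 ≤ A := (abs_nonneg _).trans (hP 0 0)
  have hM : Summable (fun p : Site D × Site D => (|w p.1| * A) * |w' p.2|) :=
    (hw.mul_right A).mul_of_nonneg hw' (fun u => mul_nonneg (abs_nonneg _) hA) (fun x => abs_nonneg _)
  refine Summable.of_norm_bounded hM (fun p => ?_)
  rw [Real.norm_eq_abs, abs_mul, abs_mul]
  exact mul_le_mul_of_nonneg_right (mul_le_mul_of_nonneg_left (hP _ _) (abs_nonneg _)) (abs_nonneg _)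

/-- [folklore] **THE DRESSED SUM OF A SPLIT**: if `F − P = Σ_{i∈I} G i` entrywise and the fibres of `P` and of every `G i` are summable, then
`dressedSumP w F w′ y − dressedSumP w P w′ y = Σ_{i∈I} dressedSumP w (G i) w′ y`. -/
theorem dressedSumP_split {ι : Type*} (I : Finset ι) {w w' : Site D → ℝ} {F P : Ker₂ D} {G : ι → Ker₂ D} (y : Site D)
    (hF : ∀ s s', F s s' - P s s' = ∑ i ∈ I, G i s s')
    (hP : Summable (fun p : Site D × Site D => w p.1 * P (y + p.1) p.2 * w' p.2))
    (hG : ∀ i ∈ I, Summable (fun p : Site D × Site D => w p.1 * G i (y + p.1) p.2 * w' p.2)) :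
    dressedSumP w F w' y - dressedSumP w P w' y = ∑ i ∈ I, dressedSumP w (G i) w' y := by
  have hsum : HasSum (fun p : Site D × Site D => ∑ i ∈ I, w p.1 * G i (y + p.1) p.2 * w' p.2)
      (∑ i ∈ I, dressedSumP w (G i) w' y) := hasSum_sum fun i hi => (hG i hi).hasSum
  have hFsum : HasSum (fun p : Site D × Site D => w p.1 * F (y + p.1) p.2 * w' p.2)
      (dressedSumP w P w' y + ∑ i ∈ I, dressedSumP w (G i) w' y) := by
    refine (hP.hasSum.add hsum).congr_fun fun p => ?_
    have e : F (y + p.1) p.2 = P (y + p.1) p.2 + ∑ i ∈ I, G i (y + p.1) p.2 := by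
      rw [← hF]; ring
    rw [e, mul_add, add_mul, Finset.mul_sum, Finset.sum_mul]
  rw [show dressedSumP w F w' y = dressedSumP w P w' y + ∑ i ∈ I, dressedSumP w (G i) w' y from hFsum.tsum_eq]
  ring

/-- [folklore] **THE SANDWICH OF A SPLIT**: matrix patterns `w` with absolutely summable entries, fine matrix two-point tables with `F − P = Σ_{i∈I} G i`
entrywise, `P` and every `G i` BOUNDED entrywise ⟹ `dressedEntryP w F y a b − dressedEntryP w P y a b = Σ_{i∈I} dressedEntryP w (G i) y a b`. -/
theorem dressedEntryP_split {ι : Type*} (I : Finset ι) {w : EKer D} {F P : EKer₂ D} {G : ι → EKer₂ D}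
    (hw : ∀ κ l, Summable fun u => |w κ l u|)
    (hF : ∀ c e s s', F c e s s' - P c e s s' = ∑ i ∈ I, G i c e s s')
    (hPb : ∀ c e, ∃ A, ∀ s s', |P c e s s'| ≤ A) (hGb : ∀ i ∈ I, ∀ c e, ∃ A, ∀ s s', |G i c e s s'| ≤ A)
    (y : Site D) (a b : Fin D) :
    dressedEntryP w F y a b - dressedEntryP w P y a b = ∑ i ∈ I, dressedEntryP w (G i) y a b := by
  unfold dressedEntryP
  rw [← Finset.sum_sub_distrib]
  have step : ∀ c, (∑ e, dressedSumP (w c a) (F c e) (w e b) y) - ∑ e, dressedSumP (w c a) (P c e) (w e b) y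
      = ∑ e, ∑ i ∈ I, dressedSumP (w c a) (G i c e) (w e b) y := fun c => by
    rw [← Finset.sum_sub_distrib]
    refine Finset.sum_congr rfl fun e _ => ?_
    obtain ⟨A, hA⟩ := hPb c e
    exact dressedSumP_split I y (hF c e) (summable_dressedP_fibre_of_bounded (hw c a) hA (hw e b) y)
      (fun i hi => by
        obtain ⟨Ai, hAi⟩ := hGb i hi c e
        exact summable_dressedP_fibre_of_bounded (hw c a) hAi (hw e b) y)
  simp only [step]
  exact (Finset.sum_congr rfl fun c _ => Finset.sum_comm).trans Finset.sum_comm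

end Linear

/-! ## §3 THE ADAPTER: the END's `hsplit` from a split of fine two-point tables -/

section Adapter

/-- [folklore] A truncated kernel is bounded by any bound of the kernel. -/
theorem abs_truncK_le {Kf : EKer 4} {c e : Fin 4} {A : ℝ} (hA : ∀ t, |Kf c e t| ≤ A) (R : ℕ) (t : Pt) :
    |truncK Kf R c e t| ≤ A := by
  unfold truncK
  split_ifs
  · exact hA t
  · rw [abs_zero]; exact (abs_nonneg _).trans (hA 0)

/-- [folklore] The sandwich's base-`0` columns are absolutely summable when the END's columns are (they are reflections of each other). -/
theorem summable_abs_colH_of_colOf {K : MKer (3 + 1) (Fib 3)} (hcol : ∀ κ l : Fin 4, Summable fun u => |colOf K κ l u|) (n : ℕ)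
    (c a : Fin 4) : Summable fun u => |colH K n a 0 c u| := by
  have h : (fun u => |colOf K c a u|) ∘ (Equiv.neg (Site 4)) = fun u => |colH K n a 0 c u| := by
    funext u
    show |colOf K c a (-u)| = |colH K n a 0 c u|
    rw [colOf_eq_colH_neg K n, neg_neg]
  rw [← h]
  exact (Equiv.summable_iff _).mpr (hcol c a)

/-- [folklore] **`hsplit` FROM A FINE SPLIT.**  Families of packed kernels `K m`, block sizes `Nb m`, coarse tables `T m`, fine matrix two-point
tables `F m`, finitely many fine piece tables `G i m` (`i ∈ I`), a bounded fine kernel `K_f`.  IF (sandwich) `T m μ ν u = dressedEntryP (c a ↦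
colH (K m) (Nb m) a 0 c) (F m) (Nb m•(−u)) μ ν`, (fine split) `F m c e s s′ − (Nb m)⁸·truncK K_f (Nb m) c e (s′ − s) = Σ_{i∈I} G i m c e s s′`, the pieces
are bounded and the END's columns `colOf (K m)` absolutely summable, THEN the END's split holds LITERALLY:
`T m μ ν u − (Nb m)⁸·dressedEntry (colOf (K m)) (truncK K_f (Nb m)) (Nb m•u) μ ν = Σ_{i∈I} dressedEntryP (c a ↦ colH (K m) (Nb m) a 0 c) (G i m) (Nb m•(−u)) μ ν`. -/
theorem hsplit_of_fineSplit {ι : Type*} (I : Finset ι) {K : ℕ → MKer (3 + 1) (Fib 3)} {Nb : ℕ → ℕ} {Kf : EKer 4}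
    {T : ℕ → Fin 4 → Fin 4 → Pt → ℝ} {F : ℕ → EKer₂ 4} {G : ι → ℕ → EKer₂ 4} {μ ν : Fin 4}
    (hKf : ∀ c e : Fin 4, ∃ A, ∀ t, |Kf c e t| ≤ A)
    (hcol : ∀ m, 1 ≤ m → ∀ κ l : Fin 4, Summable fun u => |colOf (K m) κ l u|)
    (hsand : ∀ m, 1 ≤ m → ∀ u : Pt,
      T m μ ν u = dressedEntryP (fun c a => colH (K m) (Nb m) a 0 c) (F m) (((Nb m : ℕ) : ℤ) • (-u)) μ ν)
    (hfine : ∀ m, 1 ≤ m → ∀ (c e : Fin 4) (s s' : Pt),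
      F m c e s s' - ((Nb m : ℕ) : ℝ) ^ 8 * truncK Kf (Nb m) c e (s' - s) = ∑ i ∈ I, G i m c e s s')
    (hGb : ∀ i ∈ I, ∀ m, 1 ≤ m → ∀ c e : Fin 4, ∃ A, ∀ s s', |G i m c e s s'| ≤ A) :
    ∀ m, 1 ≤ m → ∀ u : Pt,
      T m μ ν u - ((Nb m : ℕ) : ℝ) ^ 8 * dressedEntry (colOf (K m)) (truncK Kf (Nb m)) (((Nb m : ℕ) : ℤ) • u) μ ν
        = ∑ i ∈ I, dressedEntryP (fun c a => colH (K m) (Nb m) a 0 c) (G i m) (((Nb m : ℕ) : ℤ) • (-u)) μ ν := by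
  intro m hm u
  rw [hsand m hm u, transport_eq_dressedEntryP (K m) (Nb m) Kf u μ ν]
  refine dressedEntryP_split I (fun κ l => summable_abs_colH_of_colOf (hcol m hm) (Nb m) κ l)
    (P := fun c e s s' => ((Nb m : ℕ) : ℝ) ^ 8 * truncK Kf (Nb m) c e (s' - s)) (hfine m hm) (fun c e => ?_)
    (fun i hi c e => hGb i hi m hm c e) _ μ ν
  obtain ⟨A, hA⟩ := hKf c e
  refine ⟨((Nb m : ℕ) : ℝ) ^ 8 * A, fun s s' => ?_⟩
  rw [abs_mul, abs_pow, Nat.abs_cast]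
  exact mul_le_mul_of_nonneg_left (abs_truncK_le hA _ _) (by positivity)

end Adapter

/-! ## §4 The γ-END capstone with `hsplit` replaced by a fine split -/

section Capstone

variable {Lc : ℕ} [NeZero Lc]

/-- **(ASYMP) AT THE EXPLICIT KERNEL, MODULO A FINE SPLIT AND THE PIECE LEDGER** [our object] (`PerfectAsymptoticsBF.hasym_PiBF_of_pieces` with its
coarse split hypothesis `hsplit` REPLACED by: the sandwich form `hsand` of the coarse tables `T m` through the base-`0` columns of the perfect resolvent,
a split `hfine` of the FINE two-point tables `F m` against the transported kernel `(Lc^m)⁸·truncK PiBF (Lc^m) c e (s′ − s)` into bounded pieces `G i m`;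
the column letter is DISCHARGED at the perfect resolvent (`entryHyps_perfCol_zero`) and the boundedness of `PiBF` by (K6) `sextic_PiBF`; the (rem) ledger
`hpieces` is asked of the INDUCED coarse pieces `u ↦ dressedEntryP (colH-columns) (G i m) (Lc^m•(−u)) μ ν`).  Conclusion unchanged:
`∃ U₀ ≥ 0, ∃ Cg, ∀ m ≥ 1, |secondMoment (T m) μ ν − m·stepBal N Lc| ≤ (U₀ + Σ_{i∈I} B i) + Cg`. -/
theorem hasym_PiBF_of_fineSplit (hLc : 2 ≤ Lc) (wg wgh : ℝ)
    {V : Fin 4 → Site 4 → MKer 4 (Fib 3)} {W : Fin 4 → Site 4 → Fin 4 → Site 4 → MKer 4 (Fib 3)}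
    {v : Fin 4 → Site 4 → MKer 4 Unit} {w : Fin 4 → Site 4 → Fin 4 → Site 4 → MKer 4 Unit} {Cv Cw Cx Cw' Cx' CwL CwL' cQ δ : ℝ} (hδ : 0 < δ)
    -- admissible-family letters, gluon sector
    (hV : ∀ (μ : Fin 4) (y : Site 4), BiLoc (V μ y) y y Cv δ) (hW : ∀ (μ : Fin 4) (y : Site 4) (ν : Fin 4) (y' : Site 4), BiLoc (W μ y ν y') y y' Cw δ)
    (hcovV : ∀ (μ : Fin 4) (y t : Site 4), V μ (y + t) = shiftK (-t) (V μ y))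
    (hcovW : ∀ (μ : Fin 4) (y : Site 4) (ν : Fin 4) (y' t : Site 4), W μ (y + t) ν (y' + t) = shiftK (-t) (W μ y ν y'))
    (X : Site 4 → MKer 4 (Fib 3)) (hX : ∀ y, BiLoc (X y) y y Cx δ)
    (hW1 : ∀ y, comp (comp Pker (divV V y)) Pker = comp Pker (X y) - comp (X y) Pker)
    (hW2 : ∀ y ν y', divW W y ν y' = comp (X y) (V ν y') - comp (V ν y') (X y))
    (hreflP : ∀ α : Fin 4, ∃ Φα : LegMap 4 (Fib 3), refK Φα Pker = Pker ∧ ∃ c : ℤ,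
      (∀ μ y, V μ (bondRefl α c μ y) = reflSign α μ • refK Φα (V μ y)) ∧
      (∀ μ y ν y', W μ (bondRefl α c μ y) ν (bondRefl α c ν y') = (reflSign α μ * reflSign α ν) • refK Φα (W μ y ν y')))
    (h0V : ∀ (lam α β : Fin 4), ∑' p : Pt × Pt, V lam 0 p.1 p.2 (Sum.inl α) (Sum.inl β) = 0)
    (hgermV : cubicGermOf V = cQ • bfGerm)
    (hWloc : ∀ (μ ν : Fin 4) (z : Pt), BiLoc (W μ 0 ν z) 0 z (CwL * Real.exp (-δ * l1 z)) δ)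
    -- admissible-family letters, ghost sector
    (hv : ∀ (μ : Fin 4) (y : Site 4), BiLoc (v μ y) y y Cv δ) (hw : ∀ (μ : Fin 4) (y : Site 4) (ν : Fin 4) (y' : Site 4), BiLoc (w μ y ν y') y y' Cw' δ)
    (hcovv : ∀ (μ : Fin 4) (y t : Site 4), v μ (y + t) = shiftK (-t) (v μ y))
    (hcovw : ∀ (μ : Fin 4) (y : Site 4) (ν : Fin 4) (y' t : Site 4), w μ (y + t) ν (y' + t) = shiftK (-t) (w μ y ν y'))
    (Xg : Site 4 → MKer 4 Unit) (hXg : ∀ y, BiLoc (Xg y) y y Cx' δ)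
    (hW1g : ∀ y, comp (comp G0ker (divV v y)) G0ker = comp G0ker (Xg y) - comp (Xg y) G0ker)
    (hW2g : ∀ y ν y', divW w y ν y' = comp (Xg y) (v ν y') - comp (v ν y') (Xg y))
    (hreflG : ∀ α : Fin 4, ∃ Ψα : LegMap 4 Unit, refK Ψα G0ker = G0ker ∧ ∃ c : ℤ,
      (∀ μ y, v μ (bondRefl α c μ y) = reflSign α μ • refK Ψα (v μ y)) ∧
      (∀ μ y ν y', w μ (bondRefl α c μ y) ν (bondRefl α c ν y') = (reflSign α μ * reflSign α ν) • refK Ψα (w μ y ν y')))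
    (h0v : ∀ lam : Fin 4, ∑' p : Pt × Pt, v lam 0 p.1 p.2 () () = 0)
    (hgermv : cubicGermOfSc v = ghostGerm)
    (hwloc : ∀ (μ ν : Fin 4) (z : Pt), BiLoc (w μ 0 ν z) 0 z (CwL' * Real.exp (-δ * l1 z)) δ)
    -- the colour weights and the entry
    {N : ℝ} (hn : (40 * wg * (1 / 4 : ℝ) * (c4 * cQ) ^ 2 - wgh * (-(1 / 2 : ℝ)) * c4 ^ 2) / 3 = kappaBal N)
    {μ ν : Fin 4} (hμν : μ ≠ ν)
    -- the sandwich form of the coarse tables, the FINE split against the transported `PiBF`, bounded pieces, and the piece ledger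
    {T : ℕ → Fin 4 → Fin 4 → Pt → ℝ} {F : ℕ → EKer₂ 4} {ι : Type*} (I : Finset ι) {G : ι → ℕ → EKer₂ 4} {B : ι → ℝ}
    (hsand : ∀ m : ℕ, 1 ≤ m → ∀ u : Pt,
      T m μ ν u = dressedEntryP (fun c a => colH (KPerf (d := 3) Lc (sfStep Lc) (smStep 3 Lc) m) (Lc ^ m) a 0 c) (F m)
        (((Lc ^ m : ℕ) : ℤ) • (-u)) μ ν)
    (hfine : ∀ m : ℕ, 1 ≤ m → ∀ (c e : Fin 4) (s s' : Pt),
      F m c e s s' - ((Lc ^ m : ℕ) : ℝ) ^ 8 * truncK (PiBF wg wgh V W v w) (Lc ^ m) c e (s' - s) = ∑ i ∈ I, G i m c e s s')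
    (hGb : ∀ i ∈ I, ∀ m : ℕ, 1 ≤ m → ∀ c e : Fin 4, ∃ A, ∀ s s', |G i m c e s s'| ≤ A)
    (hpieces : ∀ i ∈ I, ∀ m : ℕ, 1 ≤ m → ∀ S : Finset Pt, ∑ u ∈ S, (supNorm u : ℝ) ^ 2 *
      |dressedEntryP (fun c a => colH (KPerf (d := 3) Lc (sfStep Lc) (smStep 3 Lc) m) (Lc ^ m) a 0 c) (G i m)
        (((Lc ^ m : ℕ) : ℤ) • (-u)) μ ν| ≤ B i) :
    ∃ U₀ : ℝ, 0 ≤ U₀ ∧ ∃ Cg : ℝ, ∀ m : ℕ, 1 ≤ m →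
      |B12Beta.secondMoment (T m) μ ν - (m : ℝ) * stepBal N Lc| ≤ (U₀ + ∑ i ∈ I, B i) + Cg := by
  -- (K6) gives a bound of `PiBF`, hence of its truncations
  have hLoc : LocStencil V Cv δ := fun κ u => hV κ u
  have hcovV0 : ∀ (lam : Fin 4) (u : Site 4), V lam u = shiftK (-u) (V lam 0) := fun lam u => by
    have h := hcovV lam 0 u; rwa [zero_add] at h
  have hcovv0 : ∀ (lam : Fin 4) (u : Site 4), v lam u = shiftK (-u) (v lam 0) := fun lam u => by
    have h := hcovv lam 0 u; rwa [zero_add] at h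
  obtain ⟨C, hC0, hK⟩ := sextic_PiBF (wg := wg) (wgh := wgh) (cQ := cQ) hδ hLoc hcovV0 h0V hgermV hWloc hv hcovv0 h0v hgermv hwloc
  have hKf : ∀ c e : Fin 4, ∃ A, ∀ t, |PiBF wg wgh V W v w c e t| ≤ A := fun c e =>
    ⟨C, fun t => (hK c e t).trans (div_le_self hC0 (one_le_pow₀ (by
      have : (0 : ℝ) ≤ (supNorm t : ℝ) := Nat.cast_nonneg _
      linarith)))⟩
  -- the column letter at the perfect resolvent
  have hcol : ∀ m, 1 ≤ m → ∀ κ l : Fin 4, Summable fun u => |colOf (KPerf (d := 3) Lc (sfStep Lc) (smStep 3 Lc) m) κ l u| :=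
    fun m hm κ l => (summable_of_absMoment₂ ((entryHyps_perfCol_zero hLc hm).absW κ l)).abs
  -- the END's `hsplit`, from the fine split
  have hsplit := hsplit_of_fineSplit I (K := fun m => KPerf (d := 3) Lc (sfStep Lc) (smStep 3 Lc) m) (Nb := fun m => Lc ^ m)
    (T := T) (F := F) (G := G) (μ := μ) (ν := ν) hKf hcol hsand hfine hGb
  exact hasym_PiBF_of_pieces hLc wg wgh hδ hV hW hcovV hcovW X hX hW1 hW2 hreflP h0V hgermV hWloc hv hw hcovv hcovw Xg hXg hW1g hW2g
    hreflG h0v hgermv hwloc hn hμν I hsplit hpieces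

end Capstone

end Summit.QuantumFields.BalabanUV.Beta.FP.FineSplitJunction

end
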